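import Summits.MatrixMultiplication.MatrixMultiplication.Theorems.SoloInformedSemisimple111
import Mathlib.LinearAlgebra.Eigenspace.Semisimple
import Mathlib.Algebra.DirectSum.Module
import HarnessLib

/-!
# A common eigenbasis for the 111-algebra of a reversible tensor (towards Theorem U)

Solo programme `solo-MatrixMultiplication-informed` (gen 20).  Linear-algebra and 111-algebra
preliminaries for Theorem U (`SoloInformedAbundantUnit`): a concise, 111-abundant tensor of cubic
format `d` with maximal asymptotic subrank `Q̃(s) = d` is a unit tensor.

* **E4** (`exists_basis_common_eigenvector`, `exists_basis_conj_diagonal`): over an algebraically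
  closed field, a family of pairwise commuting SEMISIMPLE endomorphisms of a finite-dimensional
  space (resp. of commuting matrices with semisimple `toLin'`) has a common eigenbasis, indexed by
  `Fin d`, `d = dim V`; in that basis every conjugated matrix `D P E` is diagonal.  (Simultaneous
  generalised eigenspaces as in E3 of `SoloInformedOneOneOneAlgebra`; for semisimple maps the
  generalised eigenspaces are eigenspaces; `DirectSum.IsInternal.collectedBasis`.)
* **Theorem S on all three legs** (`asymptoticSubrank_lt_card_of_not_isSemisimple₂/₃`): for
  concise `s ∈ ℂ^{d×d×d}` and `(P,Q,R) ∈ 𝔞(s)`, if `Q` (or `R`) is not semisimple then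
  `Q̃(s) < d` — nilpotency and non-vanishing transfer between the components of a triple through
  the powers `(Pᵏ,Qᵏ,Rᵏ) ∈ 𝔞(s)` and conciseness, so Theorem S (leg `A`) applies verbatim.
* **Commutativity on legs `B`, `C`** (`IsTriple.comm₂`, `IsTriple.comm₃`) from `IsTriple.comm₁`,
  `IsTriple.mul` and injectivity of the first projection.

References: [cite: BlaserLysikov2020, Thm. 16, Thm. 17, §2.3]; [cite: JelisiejewLandsbergPal2023,
Def. 1.9, Thm. 1.10].
-/

open scoped BigOperators Matrix
open Matrix Polynomial

namespace Summit.MatrixMultiplication.MatrixMultiplication.Theorems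

open Literature.Computability.AlgebraicComplexity

namespace CommonEigenbasis

open OneOneOneAlgebra NilpotentUnstable Semisimple111 SquareZeroNormalForm

/-! ## E4: a common eigenbasis for commuting semisimple endomorphisms -/

section E4

open Module Module.End Set

variable {K : Type*} [Field K] {V : Type*} [AddCommGroup V] [Module K V] [FiniteDimensional K V]

/-- **E4.** Over an algebraically closed field, a family of pairwise commuting semisimple
endomorphisms of a finite-dimensional space `V` admits a common eigenbasis (indexed by `Fin d`,
`d = dim V`). [folklore] -/
theorem exists_basis_common_eigenvector [IsAlgClosed K] {I : Type*} (F : I → End K V)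
    (hcomm : ∀ i j, Commute (F i) (F j)) (hss : ∀ i, (F i).IsSemisimple) {d : ℕ}
    (hd : finrank K V = d) :
    ∃ b : Module.Basis (Fin d) K V, ∀ i a, ∃ c : K, F i (b a) = c • b a := by
  classical
  set E : (I → K) → Submodule K V := fun χ => ⨅ i, (F i).maxGenEigenspace (χ i) with hE
  have hmaps : ∀ i j : I, ∀ φ : K,
      MapsTo (F i) ((F j).maxGenEigenspace φ) ((F j).maxGenEigenspace φ) :=
    fun i j φ => mapsTo_maxGenEigenspace_of_comm (hcomm j i) φ
  have hind : iSupIndep E := Module.End.independent_iInf_maxGenEigenspace_of_forall_mapsTo F hmaps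
  have htop : ⨆ χ, E χ = ⊤ := Module.End.iSup_iInf_maxGenEigenspace_eq_top_of_forall_mapsTo F
    hmaps fun i => Module.End.iSup_maxGenEigenspace_eq_top (F i)
  haveI : Fintype {χ // E χ ≠ ⊥} := hind.fintypeNeBotOfFiniteDimensional
  -- on each piece every `F i` acts by the scalar `χ i` (semisimplicity)
  have hev : ∀ (χ : I → K) (i : I), ∀ v ∈ E χ, F i v = χ i • v := by
    intro χ i v hv
    have hv' : v ∈ (F i).maxGenEigenspace (χ i) := (Submodule.mem_iInf _).1 hv i
    rw [(hss i).isFinitelySemisimple.maxGenEigenspace_eq_eigenspace] at hv'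
    exact mem_eigenspace_iff.1 hv'
  -- internal direct sum over the non-trivial pieces
  have hind' : iSupIndep (fun χ : {χ // E χ ≠ ⊥} => E χ.1) := hind.comp Subtype.val_injective
  have htop' : ⨆ χ : {χ // E χ ≠ ⊥}, E χ.1 = ⊤ := (iSup_ne_bot_subtype E).trans htop
  have hint : DirectSum.IsInternal (fun χ : {χ // E χ ≠ ⊥} => E χ.1) :=
    (DirectSum.isInternal_submodule_iff_iSupIndep_and_iSup_eq_top _).2 ⟨hind', htop'⟩
  let b₀ := hint.collectedBasis fun χ : {χ // E χ ≠ ⊥} => Module.finBasis K (E χ.1)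
  have hcardS : Fintype.card (Σ χ : {χ // E χ ≠ ⊥}, Fin (finrank K (E χ.1))) = d := by
    rw [← hd, Module.finrank_eq_card_basis b₀]
  let e := Fintype.equivFinOfCardEq hcardS
  refine ⟨b₀.reindex e, fun i a => ⟨(e.symm a).1.1 i, ?_⟩⟩
  rw [Module.Basis.reindex_apply]
  exact hev _ i _ (hint.collectedBasis_mem _ (e.symm a))

/-- **E4 for matrices.** Pairwise commuting square matrices whose endomorphisms are semisimple are
simultaneously diagonalised by some basis `b` of `K^n` indexed by `Fin d`, `d = |n|`:
`D_b P E_b` is diagonal for every member `P` of the family. [folklore] -/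
theorem exists_basis_conj_diagonal [IsAlgClosed K] {n : Type*} [Fintype n] [DecidableEq n]
    {I : Type*} (P : I → Matrix n n K) (hcomm : ∀ i j, P i * P j = P j * P i)
    (hss : ∀ i, Module.End.IsSemisimple (Matrix.toLin' (P i))) {d : ℕ}
    (hd : Fintype.card n = d) :
    ∃ b : Module.Basis (Fin d) K (n → K), ∀ i, ∃ v : Fin d → K,
      dualMat b * P i * vecMat b = Matrix.diagonal v := by
  have hcomm' : ∀ i j, Commute (Matrix.toLin' (P i)) (Matrix.toLin' (P j)) := fun i j => by
    change Matrix.toLin' (P i) * Matrix.toLin' (P j) = Matrix.toLin' (P j) * Matrix.toLin' (P i)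
    rw [Module.End.mul_eq_comp, Module.End.mul_eq_comp, ← Matrix.toLin'_mul, ← Matrix.toLin'_mul,
      hcomm]
  obtain ⟨b, hb⟩ := exists_basis_common_eigenvector (fun i => Matrix.toLin' (P i)) hcomm' hss
    (by rw [Module.finrank_fintype_fun_eq_card, hd])
  refine ⟨b, fun i => ?_⟩
  choose c hc using hb i
  refine ⟨c, ?_⟩
  rw [dualMat_mul_mul_vecMat]
  ext a a'
  rw [LinearMap.toMatrix_apply, hc a', map_smul, Module.Basis.repr_self, Finsupp.smul_apply,
    Finsupp.single_apply, Matrix.diagonal_apply, smul_eq_mul]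
  by_cases h : a = a'
  · subst h; simp
  · simp [h, Ne.symm h]

end E4

/-! ## Transfer between the components of a triple; Theorem S on legs `B` and `C` -/

section Legs

variable {K : Type*} [Field K] {ι κ μ : Type*} [Fintype ι] [Fintype κ] [Fintype μ]
  [DecidableEq ι] [DecidableEq κ] [DecidableEq μ]

omit [Fintype κ] [Fintype μ] [DecidableEq ι] [DecidableEq κ] [DecidableEq μ] in
/-- `0 ·₁ T = 0`. [folklore] -/
theorem contract₁_zero (T : ι → κ → μ → K) : contract₁ (0 : Matrix ι ι K) T = 0 := by
  funext z x y; simp [contract₁_apply]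

omit [Fintype ι] [Fintype μ] [DecidableEq ι] [DecidableEq κ] [DecidableEq μ] in
/-- `0 ·₂ T = 0`. [folklore] -/
theorem contract₂_zero (T : ι → κ → μ → K) : contract₂ (0 : Matrix κ κ K) T = 0 := by
  funext z x y; simp [contract₂_apply]

omit [Fintype ι] [Fintype κ] [DecidableEq ι] [DecidableEq κ] [DecidableEq μ] in
/-- `0 ·₃ T = 0`. [folklore] -/
theorem contract₃_zero (T : ι → κ → μ → K) : contract₃ (0 : Matrix μ μ K) T = 0 := by
  funext z x y; simp [contract₃_apply]

omit [Fintype ι] [Fintype μ] [DecidableEq ι] [DecidableEq κ] [DecidableEq μ] in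
/-- `contract₂` respects subtraction. [folklore] -/
theorem contract₂_sub (Q Q' : Matrix κ κ K) (T : ι → κ → μ → K) :
    contract₂ (Q - Q') T = contract₂ Q T - contract₂ Q' T := by
  funext z x y
  simp only [contract₂_apply, Pi.sub_apply, Matrix.sub_apply, sub_mul, Finset.sum_sub_distrib]

omit [Fintype ι] [Fintype κ] [DecidableEq ι] [DecidableEq κ] [DecidableEq μ] in
/-- `contract₃` respects subtraction. [folklore] -/
theorem contract₃_sub (Rm Rm' : Matrix μ μ K) (T : ι → κ → μ → K) :
    contract₃ (Rm - Rm') T = contract₃ Rm T - contract₃ Rm' T := by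
  funext z x y
  simp only [contract₃_apply, Pi.sub_apply, Matrix.sub_apply, sub_mul, Finset.sum_sub_distrib]

omit [DecidableEq ι] [DecidableEq κ] [DecidableEq μ] in
/-- Injectivity of the first projection at the level of triples: the `B`-component is determined
by the `A`-component (for `B`-concise `T`). [cite: JelisiejewLandsbergPal2023, Thm. 1.10] -/
theorem IsTriple.snd_unique {T : ι → κ → μ → K} (hB : LinearIndependent K fun x => rotate T x)
    {P : Matrix ι ι K} {Q Q' : Matrix κ κ K} {Rm Rm' : Matrix μ μ K} (h : IsTriple T P Q Rm)
    (h' : IsTriple T P Q' Rm') : Q = Q' := by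
  have h0 : contract₂ (Q - Q') T = 0 := by rw [contract₂_sub, ← h.1, ← h'.1, sub_self]
  exact sub_eq_zero.1 (eq_zero_of_contract₂_eq_zero hB h0)

omit [DecidableEq ι] [DecidableEq κ] [DecidableEq μ] in
/-- Injectivity of the first projection at the level of triples: the `C`-component is determined
by the `A`-component (for `C`-concise `T`). [cite: JelisiejewLandsbergPal2023, Thm. 1.10] -/
theorem IsTriple.thd_unique {T : ι → κ → μ → K}
    (hC : LinearIndependent K fun y => rotate (rotate T) y) {P : Matrix ι ι K}
    {Q Q' : Matrix κ κ K} {Rm Rm' : Matrix μ μ K} (h : IsTriple T P Q Rm)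
    (h' : IsTriple T P Q' Rm') : Rm = Rm' := by
  have h0 : contract₃ (Rm - Rm') T = 0 := by
    rw [contract₃_sub, ← h.2, ← h.1, ← h'.2, ← h'.1, sub_self]
  exact sub_eq_zero.1 (eq_zero_of_contract₃_eq_zero hC h0)

omit [DecidableEq ι] [DecidableEq κ] [DecidableEq μ] in
/-- **Commutativity of the second projection of `𝔞(T)`** for `A`- and `B`-concise `T`.
[cite: JelisiejewLandsbergPal2023, Thm. 1.10] -/
theorem IsTriple.comm₂ {T : ι → κ → μ → K} (hA : LinearIndependent K fun z => T z)
    (hB : LinearIndependent K fun x => rotate T x) {P P' : Matrix ι ι K} {Q Q' : Matrix κ κ K}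
    {Rm Rm' : Matrix μ μ K} (h : IsTriple T P Q Rm) (h' : IsTriple T P' Q' Rm') :
    Q * Q' = Q' * Q := by
  have h1 : IsTriple T (P * P') (Q' * Q) (Rm' * Rm) := h.mul h'
  have h2 : IsTriple T (P' * P) (Q * Q') (Rm * Rm') := h'.mul h
  rw [← IsTriple.comm₁ hA h h'] at h2
  exact (IsTriple.snd_unique hB h1 h2).symm

omit [DecidableEq ι] [DecidableEq κ] [DecidableEq μ] in
/-- **Commutativity of the third projection of `𝔞(T)`** for `A`- and `C`-concise `T`.
[cite: JelisiejewLandsbergPal2023, Thm. 1.10] -/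
theorem IsTriple.comm₃ {T : ι → κ → μ → K} (hA : LinearIndependent K fun z => T z)
    (hC : LinearIndependent K fun y => rotate (rotate T) y) {P P' : Matrix ι ι K}
    {Q Q' : Matrix κ κ K} {Rm Rm' : Matrix μ μ K} (h : IsTriple T P Q Rm)
    (h' : IsTriple T P' Q' Rm') : Rm * Rm' = Rm' * Rm := by
  have h1 : IsTriple T (P * P') (Q' * Q) (Rm' * Rm) := h.mul h'
  have h2 : IsTriple T (P' * P) (Q * Q') (Rm * Rm') := h'.mul h
  rw [← IsTriple.comm₁ hA h h'] at h2
  exact (IsTriple.thd_unique hC h1 h2).symm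

/-- Nilpotency transfers from the `B`-component to the `A`-component of a triple
(for `A`-concise `T`). [cite: JelisiejewLandsbergPal2023, Thm. 1.10] -/
theorem isNilpotent₁_of_isNilpotent₂ {T : ι → κ → μ → K} (hA : LinearIndependent K fun z => T z)
    {P : Matrix ι ι K} {Q : Matrix κ κ K} {Rm : Matrix μ μ K} (h : IsTriple T P Q Rm)
    (hQ : IsNilpotent Q) : IsNilpotent P := by
  obtain ⟨k, hk⟩ := hQ
  refine ⟨k + 1, eq_zero_of_contract₁_eq_zero hA ?_⟩
  rw [(isTriple_pow h (k + 1)).1, pow_succ, hk, zero_mul, contract₂_zero]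

/-- Nilpotency transfers from the `C`-component to the `A`-component of a triple
(for `A`-concise `T`). [cite: JelisiejewLandsbergPal2023, Thm. 1.10] -/
theorem isNilpotent₁_of_isNilpotent₃ {T : ι → κ → μ → K} (hA : LinearIndependent K fun z => T z)
    {P : Matrix ι ι K} {Q : Matrix κ κ K} {Rm : Matrix μ μ K} (h : IsTriple T P Q Rm)
    (hR : IsNilpotent Rm) : IsNilpotent P := by
  obtain ⟨k, hk⟩ := hR
  refine ⟨k + 1, eq_zero_of_contract₁_eq_zero hA ?_⟩
  have hp := isTriple_pow h (k + 1)
  rw [hp.1.trans hp.2, pow_succ, hk, zero_mul, contract₃_zero]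

omit [DecidableEq ι] [DecidableEq κ] [DecidableEq μ] in
/-- Non-vanishing transfers from the `B`-component to the `A`-component (for `B`-concise `T`).
[cite: JelisiejewLandsbergPal2023, Thm. 1.10] -/
theorem ne_zero₁_of_ne_zero₂ {T : ι → κ → μ → K} (hB : LinearIndependent K fun x => rotate T x)
    {P : Matrix ι ι K} {Q : Matrix κ κ K} {Rm : Matrix μ μ K} (h : IsTriple T P Q Rm)
    (hQ : Q ≠ 0) : P ≠ 0 := by
  rintro rfl
  exact hQ (eq_zero_of_contract₂_eq_zero hB (by rw [← h.1, contract₁_zero]))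

omit [DecidableEq ι] [DecidableEq κ] [DecidableEq μ] in
/-- Non-vanishing transfers from the `C`-component to the `A`-component (for `C`-concise `T`).
[cite: JelisiejewLandsbergPal2023, Thm. 1.10] -/
theorem ne_zero₁_of_ne_zero₃ {T : ι → κ → μ → K}
    (hC : LinearIndependent K fun y => rotate (rotate T) y) {P : Matrix ι ι K}
    {Q : Matrix κ κ K} {Rm : Matrix μ μ K} (h : IsTriple T P Q Rm) (hR : Rm ≠ 0) : P ≠ 0 := by
  rintro rfl
  exact hR (eq_zero_of_contract₃_eq_zero hC (by rw [← h.2, ← h.1, contract₁_zero]))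

/-- Jordan–Chevalley for a square matrix: if `toLin' M` is not semisimple, some polynomial in `M`
is a non-zero nilpotent matrix. [folklore] -/
theorem exists_aeval_ne_zero_isNilpotent {n : Type*} [Fintype n] [DecidableEq n]
    [PerfectField K] (M : Matrix n n K) (hM : ¬ Module.End.IsSemisimple (Matrix.toLin' M)) :
    ∃ p : K[X], aeval M p ≠ 0 ∧ IsNilpotent (aeval M p) := by
  obtain ⟨nl, hn, sm, -, hnil, hss, hf⟩ :=
    Module.End.exists_isNilpotent_isSemisimple (f := Matrix.toLin' M)
  have hn0 : nl ≠ 0 := by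
    rintro rfl
    rw [zero_add] at hf
    exact hM (hf ▸ hss)
  rw [Algebra.adjoin_singleton_eq_range_aeval, AlgHom.mem_range] at hn
  obtain ⟨p, hp⟩ := hn
  have key : (Matrix.toLinAlgEquiv' : Matrix n n K ≃ₐ[K] ((n → K) →ₗ[K] (n → K))) (aeval M p) =
      nl := by
    rw [← hp]
    exact (Polynomial.aeval_algHom_apply
      (Matrix.toLinAlgEquiv' : Matrix n n K ≃ₐ[K] ((n → K) →ₗ[K] (n → K))).toAlgHom M p).symm
  refine ⟨p, fun h0 => hn0 (by rw [← key, h0, map_zero]), ?_⟩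
  have : IsNilpotent
      ((Matrix.toLinAlgEquiv' : Matrix n n K ≃ₐ[K] ((n → K) →ₗ[K] (n → K))).symm nl) :=
    hnil.map _
  simpa [← key] using this

end Legs

section TheoremS

variable {ι κ μ : Type} [Fintype ι] [Fintype κ] [Fintype μ] [DecidableEq ι] [DecidableEq κ]
  [DecidableEq μ]

/-- **Theorem S on leg `B`**: for concise `s ∈ ℂ^{d×d×d}`, a triple `(P,Q,R) ∈ 𝔞(s)` whose
SECOND component is not semisimple forces `Q̃(s) < d`.
[cite: BlaserLysikov2020, Thm. 16, Thm. 17, §2.3] -/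
theorem asymptoticSubrank_lt_card_of_not_isSemisimple₂ (s : ι → κ → μ → ℂ) (hs : IsConcise3 s)
    {d : ℕ} (hι : Fintype.card ι = d) (hκ : Fintype.card κ = d) (hμ : Fintype.card μ = d)
    {P : Matrix ι ι ℂ} {Q : Matrix κ κ ℂ} {Rm : Matrix μ μ ℂ} (htr : IsTriple s P Q Rm)
    (hQ : ¬ Module.End.IsSemisimple (Matrix.toLin' Q)) : asymptoticSubrank ℂ s < d := by
  obtain ⟨p, hp0, hpnil⟩ := exists_aeval_ne_zero_isNilpotent Q hQ
  have htr' := isTriple_aeval htr p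
  exact asymptoticSubrank_lt_card_of_isNilpotent_aeval s hs hι hκ hμ htr p
    (ne_zero₁_of_ne_zero₂ hs.2.1 htr' hp0) (isNilpotent₁_of_isNilpotent₂ hs.1 htr' hpnil)

/-- **Theorem S on leg `C`**: for concise `s ∈ ℂ^{d×d×d}`, a triple `(P,Q,R) ∈ 𝔞(s)` whose
THIRD component is not semisimple forces `Q̃(s) < d`.
[cite: BlaserLysikov2020, Thm. 16, Thm. 17, §2.3] -/
theorem asymptoticSubrank_lt_card_of_not_isSemisimple₃ (s : ι → κ → μ → ℂ) (hs : IsConcise3 s)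
    {d : ℕ} (hι : Fintype.card ι = d) (hκ : Fintype.card κ = d) (hμ : Fintype.card μ = d)
    {P : Matrix ι ι ℂ} {Q : Matrix κ κ ℂ} {Rm : Matrix μ μ ℂ} (htr : IsTriple s P Q Rm)
    (hR : ¬ Module.End.IsSemisimple (Matrix.toLin' Rm)) : asymptoticSubrank ℂ s < d := by
  obtain ⟨p, hp0, hpnil⟩ := exists_aeval_ne_zero_isNilpotent Rm hR
  have htr' := isTriple_aeval htr p
  exact asymptoticSubrank_lt_card_of_isNilpotent_aeval s hs hι hκ hμ htr p
    (ne_zero₁_of_ne_zero₃ hs.2.2 htr' hp0) (isNilpotent₁_of_isNilpotent₃ hs.1 htr' hpnil)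

/-- **Reduced on every leg**: maximal asymptotic subrank `Q̃(s) = d` of a concise
`s ∈ ℂ^{d×d×d}` forces all three components of every element of `𝔞(s)` to be semisimple.
[cite: BlaserLysikov2020, Thm. 16, Thm. 17] -/
theorem isSemisimple₁₂₃_of_asymptoticSubrank_eq_card (s : ι → κ → μ → ℂ) (hs : IsConcise3 s)
    {d : ℕ} (hι : Fintype.card ι = d) (hκ : Fintype.card κ = d) (hμ : Fintype.card μ = d)
    (hQ : asymptoticSubrank ℂ s = d) {P : Matrix ι ι ℂ} {Q : Matrix κ κ ℂ} {Rm : Matrix μ μ ℂ}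
    (htr : IsTriple s P Q Rm) :
    Module.End.IsSemisimple (Matrix.toLin' P) ∧ Module.End.IsSemisimple (Matrix.toLin' Q) ∧
      Module.End.IsSemisimple (Matrix.toLin' Rm) := by
  refine ⟨isSemisimple_of_asymptoticSubrank_eq_card s hs hι hκ hμ hQ htr, ?_, ?_⟩
  · by_contra h
    have := asymptoticSubrank_lt_card_of_not_isSemisimple₂ s hs hι hκ hμ htr h
    rw [hQ] at this
    exact lt_irrefl _ this
  · by_contra h
    have := asymptoticSubrank_lt_card_of_not_isSemisimple₃ s hs hι hκ hμ htr h
    rw [hQ] at this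
    exact lt_irrefl _ this

end TheoremS

end CommonEigenbasis

end Summit.MatrixMultiplication.MatrixMultiplication.Theorems
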